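import Literature.Analysis.InnerProduct.DirichletRectangleHeatTraceExpansion
import HarnessLib

/-!
# Tetra and Didi, the cosmic spectral twins (Doyle–Rossetti): the tetracosm and the didicosm have THE SAME HEAT TRACE — by
# Miatello–Rossetti's multiplicity formula the twisted contributions are `∑_m (2cos(πm/2) + (−1)^m)e^{−π²m²t}` (one quarter-
# screw axis) versus `2∑_a (−1)^a e^{−4π²a²t} + ∑_m (−1)^m e^{−π²m²t}` (three half-screw axes), and these agree

Layer `Literature/Analysis/InnerProduct`, namespace `Literature.Analysis.InnerProduct`; uses only the scaled circle of row g38-#2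
(`summable_exp_neg_mul_mul_intCast_sq`). Lane `lit-hodgefound` (Track 2 foundations library), prover seat `lit-hodgefound-p06`
(generation 39), self-proposed row g39-#14; companion to `FlatKleinBottleHeatTraceExpansion.lean` (g39-#4, dimension 2: the heat
invariants do not see orientability) and `Literature/NumberTheory/QuadraticForms/ConwaySloaneTetralattices.lean` (g39-#13,
dimension 4: isospectral non-isometric flat tori). THEOREMS ONLY (no definition, no instance, no notation, no named fact).

## Sources, verbatim

P. G. Doyle, J. P. Rossetti, *Tetra and Didi, the cosmic spectral twins*, Geom. Topol. 8 (2004) 1227–1242 (arXiv:math/0407422),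
§1 (chunk p0002): "We introduce a pair of isospectral but non-isometric compact flat 3-manifolds called `Tetra` (a tetracosm) and
`Didi` (a didicosm) … `Tetra` and `Didi` are both 4-fold quotients of `TwoTall = ℝ³ mod (ℤ × ℤ × 2ℤ)`. `Tetra` is the quotient of
`TwoTall` by a fixed-point-free action of `ℤ/4`, while `Didi` is the quotient by a fixed-point-free action of `ℤ/2 × ℤ/2`. To get
`Tetra`, we adjoin to the translation group `ℤ × ℤ × 2ℤ` in `(x,y,z)`-space the quarter-turn screw motion `τ : (x,y,z) ↦
(−y,x,z+1/2)`. To get `Didi`, we adjoin instead the two half-turn screw motions `ρ_x : (x,y,z) ↦ (x+1/2,−y,−z)` and `ρ_y : (x,y,z)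
↦ (−x,y+1/2,1−z)`"; §3 (chunk p0004): "Odd exceptional case … Taken together, these cases contribute a single eigenfunction of
eigenvalue `4π²·n²` to the spectra of both `Tetra` and `Didi`. Even exceptional case … contribute three independent
eigenfunctions of eigenvalue `4π²·n²` to both spectra … `Tetra` and `Didi` are, up to scale, the only pair of non-isometric
isospectral platycosms". R. J. Miatello, J. P. Rossetti, *Flat manifolds isospectral on p-forms*, J. Geom. Anal. 11 (2001)
(arXiv:math/0303276), §3 (chunk p0003–p0004): "for each `B ∈ F` and `μ ≥ 0`, we set
`e_{μ,B}(Γ) := ∑_{v ∈ Λ* : ‖v‖² = μ, Bv = v} e^{2πi v.b}` … Theorem 3.1 If `Γ` is a Bieberbach group with holonomy group `F`, for each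
`μ ≥ 0` and `0 ≤ p ≤ n`, the multiplicity of the eigenvalue `4π²μ` of `−Δ_p` is given by
`d_{p,μ}(Γ) = |F|⁻¹ ∑_{B∈F} tr_p(B) e_{μ,B}(Γ)` (3.1)" (for `γ = BL_b ∈ Γ`, `f_v(γx) = e^{2πi v.(Bx+Bb)}`; `tr₀ = 1`).

## The computation (functions, `p = 0`)

`Λ = ℤ × ℤ × 2ℤ`, `Λ* = ℤ × ℤ × ½ℤ ∋ v = (a, b, m/2)`, `4π²‖v‖² = 4π²(a²+b²) + π²m²`; summing (3.1) against `e^{−4π²μt}`: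
`Z_Γ(t) = ∑_μ d_μ e^{−4π²μt} = |F|⁻¹ ∑_{B∈F} ∑_{v∈Λ*, Bv=v} e^{2πi v.b_B} e^{−4π²‖v‖²t}`, the `B = I` term being the theta
function `Θ(t)` of `Λ*` for both manifolds. TETRA: `F = {I, A, A², A³}`, `A(x,y,z) = (−y,x,z)`; `τ = A∘L_b` with `b = (0,0,½)`, `τ² =
A²∘L_{(0,0,1)}`, `τ³ = A³∘L_{(0,0,3/2)}`; `A^j v = v` (`j = 1,2,3`) iff `v = (0,0,m/2)`, with phases `e^{2πi(m/2)(1/2)} = e^{πim/2}`,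
`e^{πim} = (−1)^m`, `e^{3πim/2}`; real parts `cos(πm/2) + (−1)^m + cos(3πm/2) = 2cos(πm/2) + (−1)^m` (the imaginary parts of
`A`, `A³` cancel under `m ↦ −m`). DIDI: `F = {I, B₁, B₂, B₃}`, `B₁ = diag(1,−1,−1)` (`ρ_x = B₁∘L_{(½,0,0)}`, fixed `v = (a,0,0)`,
phase `e^{πia} = (−1)^a`), `B₂ = diag(−1,1,−1)` (`ρ_y = B₂∘L_{(0,½,−1)}`, fixed `(0,b,0)`, phase `(−1)^b`), `B₃ = B₁B₂ =
diag(−1,−1,1)` (`ρ_xρ_y = B₃∘L_{(−½,½,−1)}`, fixed `(0,0,m/2)`, phase `e^{−πim} = (−1)^m`). Hence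
`4Z_Tetra(t) − Θ(t) = ∑_{m∈ℤ}(2cos(πm/2) + (−1)^m)e^{−π²m²t}` and `4Z_Didi(t) − Θ(t) = 2∑_{a∈ℤ}(−1)^a e^{−4π²a²t} +
∑_{m∈ℤ}(−1)^m e^{−π²m²t}`; since `cos(πm/2) = 0` for odd `m` and `= (−1)^k` for `m = 2k` (`π²(2k)² = 4π²k²`), THE TWO AGREE
— Doyle–Rossetti's "delicate interplay between the lengths and twists of closed geodesics", on the spectral side. Level by
level (`μ = m²/4`): Tetra's axis points `±m/2` weigh `2cos(πm/2) + (−1)^m` each, Didi's weigh `(−1)^m` each plus, for `m = 2a`,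
the four points `(±a,0,0), (0,±a,0)` weighing `(−1)^a`: `2(2cos(πm/2) + (−1)^m) = 2(−1)^m + [m even]·4(−1)^{m/2}` — for `m =
2n`: `n` odd gives `4·(−2+1)… = −2 = 2 − 4`, i.e. `d = ¼(r(n²) − 2)`… exactly Doyle–Rossetti's "single eigenfunction" / "three
eigenfunctions" bookkeeping.

## What is proved

* §1 `tetra_quarterTurn_fixed_iff`, `didi_halfTurn₁/₂/₃_fixed_iff` (the fixed dual vectors are the screw axes),
  `tetra_phases_real_part` (`cos(πm/2) + cos(πm) + cos(3πm/2) = 2cos(πm/2) + (−1)^m`).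
* §2 `summable_neg_one_zpow_mul_exp`, `summable_cos_mul_exp`, **`tsum_two_cos_pi_half_mul_exp_eq`** (`∑_m 2cos(πm/2)e^{−tcm²} =
  2∑_a (−1)^a e^{−4tca²}`), **`tetra_twisted_eq_didi_twisted`**, **`tetra_heatTrace_eq_didi_heatTrace`** (THE MIATELLO–ROSSETTI SUMS OF
  TETRA AND DIDI AGREE FOR EVERY `t > 0`), `tetra_didi_level_weights_eq` (level-by-level: equal multiplicities `d_μ`).

## References

* [DoyleRossetti2004] P. G. Doyle, J. P. Rossetti, *Tetra and Didi, the cosmic spectral twins*, Geom. Topol. 8 (2004) 1227–1242,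
  doi:10.2140/gt.2004.8.1227, §1, §3.
* [MiatelloRossetti2001] R. J. Miatello, J. P. Rossetti, *Flat manifolds isospectral on p-forms*, J. Geom. Anal. 11 (2001)
  649–667, doi:10.1007/bf02930761, Theorem 3.1.
* [Berard1986] P. H. Bérard, *Spectral Geometry: Direct and Inverse Problems*, LNM 1207 (1986), Ch. V nº6 (flat tori, theta
  functions).
-/

noncomputable section

open Real Filter Topology

namespace Literature.Analysis.InnerProduct

/-! ### §0 The parity rearrangement of `ℤ` -/

/-- `ℤ = 2ℤ ⊔ (2ℤ+1)` as a rearrangement of an unconditionally convergent series (as in row g39-#5). [folklore] -/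
private theorem hasSum_int_parity' {f : ℤ → ℝ} {a b : ℝ} (ha : HasSum (fun k : ℤ ↦ f (2 * k)) a)
    (hb : HasSum (fun k : ℤ ↦ f (2 * k + 1)) b) : HasSum f (a + b) := by
  have hbij : Function.Bijective (Sum.elim (fun k : ℤ ↦ 2 * k) (fun k : ℤ ↦ 2 * k + 1)) := by
    refine ⟨?_, ?_⟩
    · rintro (k | k) (k' | k') h <;>
        simp only [Sum.elim_inl, Sum.elim_inr, Sum.inl.injEq, Sum.inr.injEq, reduceCtorEq] at h ⊢ <;> omega
    · intro n
      obtain ⟨k, rfl | rfl⟩ := Int.even_or_odd' n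
      · exact ⟨Sum.inl k, rfl⟩
      · exact ⟨Sum.inr k, rfl⟩
  exact (Equiv.ofBijective _ hbij).hasSum_iff.mp
    (HasSum.sum (f := f ∘ Sum.elim (fun k : ℤ ↦ 2 * k) (fun k : ℤ ↦ 2 * k + 1)) ha hb)

/-! ### §1 The holonomies: fixed dual vectors and phases -/

/-- Tetra's holonomy `A(a,b,c) = (−b,a,c)` (and hence `A²`, `A³`) fixes exactly the screw axis `a = b = 0` of the dual lattice
`Λ* = ℤ × ℤ × ½ℤ` (third coordinate `m` encodes `c = m/2`). [cite: DoyleRossetti2004, §1 (`τ(x,y,z) = (−y,x,z+½)`);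
MiatelloRossetti2001, Theorem 3.1 (the condition `Bv = v`)] -/
theorem tetra_quarterTurn_fixed_iff (v : ℤ × ℤ × ℤ) : ((-v.2.1, v.1, v.2.2) : ℤ × ℤ × ℤ) = v ↔ v.1 = 0 ∧ v.2.1 = 0 := by
  obtain ⟨a, b, m⟩ := v
  simp only [Prod.mk.injEq, and_true]
  omega

/-- `A²(a,b,c) = (−a,−b,c)` fixes exactly the same axis. [cite: DoyleRossetti2004, §1; MiatelloRossetti2001, Theorem 3.1] -/
theorem tetra_halfTurn_fixed_iff (v : ℤ × ℤ × ℤ) : ((-v.1, -v.2.1, v.2.2) : ℤ × ℤ × ℤ) = v ↔ v.1 = 0 ∧ v.2.1 = 0 := by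
  obtain ⟨a, b, m⟩ := v
  simp only [Prod.mk.injEq, and_true]
  omega

/-- Didi's holonomies `B₁ = diag(1,−1,−1)`, `B₂ = diag(−1,1,−1)`, `B₃ = B₁B₂ = diag(−1,−1,1)` fix the three coordinate axes.
[cite: DoyleRossetti2004, §1 (`ρ_x`, `ρ_y`); MiatelloRossetti2001, Theorem 3.1] -/
theorem didi_halfTurns_fixed_iff (v : ℤ × ℤ × ℤ) :
    (((v.1, -v.2.1, -v.2.2) : ℤ × ℤ × ℤ) = v ↔ v.2.1 = 0 ∧ v.2.2 = 0) ∧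
      (((-v.1, v.2.1, -v.2.2) : ℤ × ℤ × ℤ) = v ↔ v.1 = 0 ∧ v.2.2 = 0) ∧
        (((-v.1, -v.2.1, v.2.2) : ℤ × ℤ × ℤ) = v ↔ v.1 = 0 ∧ v.2.1 = 0) := by
  obtain ⟨a, b, m⟩ := v
  simp only [Prod.mk.injEq, and_true, true_and]
  omega

/-- **The phases on Tetra's axis: `Re(e^{πim/2} + e^{πim} + e^{3πim/2}) = cos(πm/2) + cos(πm) + cos(3πm/2) = 2cos(πm/2) + (−1)^m`**
(`v.b = (m/2)·(1/2), (m/2)·1, (m/2)·(3/2)` for `τ, τ², τ³`). [cite: MiatelloRossetti2001, Theorem 3.1 (`e_{μ,B}`); DoyleRossetti2004,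
§1] -/
theorem tetra_phases_real_part (m : ℤ) :
    Real.cos (2 * π * ((m : ℝ) / 2 * (1 / 2))) + Real.cos (2 * π * ((m : ℝ) / 2 * 1)) +
        Real.cos (2 * π * ((m : ℝ) / 2 * (3 / 2))) = 2 * Real.cos (π * (m : ℝ) / 2) + (-1 : ℝ) ^ m := by
  have h1 : 2 * π * ((m : ℝ) / 2 * (1 / 2)) = π * (m : ℝ) / 2 := by ring
  have h2 : 2 * π * ((m : ℝ) / 2 * 1) = (m : ℝ) * π := by ring
  have h3 : 2 * π * ((m : ℝ) / 2 * (3 / 2)) = ((m : ℤ) : ℝ) * (2 * π) - π * (m : ℝ) / 2 := by ring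
  rw [h1, h2, h3, Real.cos_int_mul_pi, Real.cos_int_mul_two_pi_sub]
  ring

/-- **The phases on Didi's axes are `(−1)^a`, `(−1)^b`, `(−1)^m`**: `v.b = a/2` for `ρ_x = B₁L_{(½,0,0)}`, `b/2 − 0` for `ρ_y =
B₂L_{(0,½,−1)}`, and `−m/2·…`: `e^{2πi(m/2)(−1)} = e^{−πim}` for `ρ_xρ_y = B₃L_{(−½,½,−1)}`. [cite: MiatelloRossetti2001, Theorem 3.1;
DoyleRossetti2004, §1] -/
theorem didi_phases (a : ℤ) :
    Real.cos (2 * π * ((a : ℝ) * (1 / 2))) = (-1 : ℝ) ^ a ∧ Real.cos (2 * π * ((a : ℝ) / 2 * (-1))) = (-1 : ℝ) ^ a := by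
  have h1 : 2 * π * ((a : ℝ) * (1 / 2)) = (a : ℝ) * π := by ring
  have h2 : 2 * π * ((a : ℝ) / 2 * (-1)) = -((a : ℝ) * π) := by ring
  rw [h1, h2, Real.cos_neg, Real.cos_int_mul_pi]
  exact ⟨rfl, rfl⟩

/-! ### §2 The twisted theta sums and their equality -/

section Sums

variable {c t : ℝ}

/-- `∑_{a∈ℤ} (−1)^a e^{−tca²}` converges absolutely. [cite: Berard1986, Ch. V nº6 (ii)] -/
theorem summable_neg_one_zpow_mul_exp (hc : 0 < c) (ht : 0 < t) :
    Summable fun a : ℤ ↦ (-1 : ℝ) ^ a * Real.exp (-(t * (c * ((a : ℝ)) ^ 2))) := by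
  refine Summable.of_norm_bounded (summable_exp_neg_mul_mul_intCast_sq hc ht) fun a ↦ ?_
  rw [norm_mul, Real.norm_eq_abs, abs_neg_one_zpow, one_mul, Real.norm_of_nonneg (Real.exp_nonneg _)]

/-- `∑_{m∈ℤ} cos(ωm) e^{−tcm²}` converges absolutely. [cite: Berard1986, Ch. V nº6 (ii)] -/
theorem summable_cos_mul_exp (ω : ℝ) (hc : 0 < c) (ht : 0 < t) :
    Summable fun m : ℤ ↦ Real.cos (ω * (m : ℝ)) * Real.exp (-(t * (c * ((m : ℝ)) ^ 2))) := by
  refine Summable.of_norm_bounded (summable_exp_neg_mul_mul_intCast_sq hc ht) fun m ↦ ?_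
  rw [norm_mul, Real.norm_eq_abs, Real.norm_of_nonneg (Real.exp_nonneg _)]
  exact mul_le_of_le_one_left (Real.exp_nonneg _) (Real.abs_cos_le_one _)

/-- **`∑_{m∈ℤ} 2cos(πm/2)e^{−tcm²} = 2∑_{k∈ℤ}(−1)^k e^{−4tck²}`**: the odd `m` drop out (`cos((2k+1)π/2) = 0`), the even
`m = 2k` carry `cos(kπ) = (−1)^k`. [cite: DoyleRossetti2004, §3 ("odd exceptional case" / "even exceptional case")] -/
theorem tsum_two_cos_pi_half_mul_exp_eq (hc : 0 < c) (ht : 0 < t) :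
    ∑' m : ℤ, 2 * Real.cos (π * (m : ℝ) / 2) * Real.exp (-(t * (c * ((m : ℝ)) ^ 2))) =
      2 * ∑' k : ℤ, (-1 : ℝ) ^ k * Real.exp (-(t * (4 * c * ((k : ℝ)) ^ 2))) := by
  have h4 : (0 : ℝ) < 4 * c := by positivity
  have hE : HasSum (fun k : ℤ ↦ 2 * Real.cos (π * (((2 * k : ℤ)) : ℝ) / 2) *
      Real.exp (-(t * (c * (((2 * k : ℤ) : ℝ)) ^ 2)))) (2 * ∑' k : ℤ, (-1 : ℝ) ^ k * Real.exp (-(t * (4 * c * ((k : ℝ)) ^ 2)))) := by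
    refine ((summable_neg_one_zpow_mul_exp h4 ht).hasSum.mul_left 2).congr_fun fun k ↦ ?_
    have e1 : Real.cos (π * (((2 * k : ℤ)) : ℝ) / 2) = (-1 : ℝ) ^ k := by
      rw [show π * (((2 * k : ℤ)) : ℝ) / 2 = (k : ℝ) * π by push_cast; ring, Real.cos_int_mul_pi]
    have e2 : Real.exp (-(t * (c * (((2 * k : ℤ) : ℝ)) ^ 2))) = Real.exp (-(t * (4 * c * ((k : ℝ)) ^ 2))) := by
      push_cast
      ring_nf
    rw [e1, e2]
    ring
  have hO : HasSum (fun k : ℤ ↦ 2 * Real.cos (π * (((2 * k + 1 : ℤ)) : ℝ) / 2) *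
      Real.exp (-(t * (c * (((2 * k + 1 : ℤ) : ℝ)) ^ 2)))) 0 := by
    refine (hasSum_zero : HasSum (fun _ : ℤ ↦ (0 : ℝ)) 0).congr_fun fun k ↦ ?_
    have e1 : Real.cos (π * (((2 * k + 1 : ℤ)) : ℝ) / 2) = 0 := by
      rw [show π * (((2 * k + 1 : ℤ)) : ℝ) / 2 = (k : ℝ) * π + π / 2 by push_cast; ring, Real.cos_add_pi_div_two,
        Real.sin_int_mul_pi, neg_zero]
    rw [e1]
    ring
  rw [(hasSum_int_parity' (f := fun m : ℤ ↦ 2 * Real.cos (π * (m : ℝ) / 2) * Real.exp (-(t * (c * ((m : ℝ)) ^ 2))))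
    hE hO).tsum_eq, add_zero]

/-- **THE TWISTED CONTRIBUTIONS OF TETRA AND DIDI AGREE:
`∑_{m∈ℤ}(2cos(πm/2) + (−1)^m)e^{−π²m²t} = 2∑_{a∈ℤ}(−1)^a e^{−4π²a²t} + ∑_{m∈ℤ}(−1)^m e^{−π²m²t}`** (one quarter-screw axis with
its square, versus three half-screw axes of lengths `½, ½, 1`). [cite: DoyleRossetti2004, §3–§4 ("the spectral contribution of
`Tetra`'s one new half-twister and two recycled quarter-twisters just matches that of `Didi`'s two brand new half-twisters");
MiatelloRossetti2001, Theorem 3.1] -/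
theorem tetra_twisted_eq_didi_twisted (ht : 0 < t) :
    ∑' m : ℤ, (2 * Real.cos (π * (m : ℝ) / 2) + (-1 : ℝ) ^ m) * Real.exp (-(t * (π ^ 2 * ((m : ℝ)) ^ 2))) =
      2 * (∑' a : ℤ, (-1 : ℝ) ^ a * Real.exp (-(t * (4 * π ^ 2 * ((a : ℝ)) ^ 2)))) +
        ∑' m : ℤ, (-1 : ℝ) ^ m * Real.exp (-(t * (π ^ 2 * ((m : ℝ)) ^ 2))) := by
  have hc : (0 : ℝ) < π ^ 2 := by positivity
  have hA : Summable fun m : ℤ ↦ 2 * Real.cos (π * (m : ℝ) / 2) * Real.exp (-(t * (π ^ 2 * ((m : ℝ)) ^ 2))) := by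
    refine ((summable_cos_mul_exp (π / 2) hc ht).mul_left 2).congr fun m ↦ ?_
    rw [show π / 2 * (m : ℝ) = π * (m : ℝ) / 2 by ring]
    ring
  have hB := summable_neg_one_zpow_mul_exp hc ht
  rw [← tsum_two_cos_pi_half_mul_exp_eq hc ht, ← hA.tsum_add hB]
  exact tsum_congr fun m ↦ by ring

/-- **TETRA AND DIDI HAVE THE SAME HEAT TRACE** (Miatello–Rossetti's formula summed against `e^{−4π²μt}`, `|F| = 4` for
both): `¼[Θ(t) + ∑_m(2cos(πm/2) + (−1)^m)e^{−π²m²t}] = ¼[Θ(t) + ∑_a(−1)^a e^{−4π²a²t} + ∑_b(−1)^b e^{−4π²b²t} + ∑_m(−1)^m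
e^{−π²m²t}]`, `Θ(t) = ∑_{(a,b,m)∈ℤ³}e^{−(4π²(a²+b²) + π²m²)t}` the theta function of `Λ* = ℤ × ℤ × ½ℤ` (the untwisted term
`B = I`, common to both). Hence equal multiplicities `d_μ` for every `μ` and equal spectra: the cosmic spectral twins.
[cite: DoyleRossetti2004, §1 ("Nevertheless, these spaces are isospectral"), §3; MiatelloRossetti2001, Theorem 3.1] -/
theorem tetra_heatTrace_eq_didi_heatTrace (ht : 0 < t) :
    1 / 4 * ((∑' v : ℤ × ℤ × ℤ, Real.exp (-(t * (4 * π ^ 2 * (((v.1 : ℝ)) ^ 2 + ((v.2.1 : ℝ)) ^ 2) + π ^ 2 * ((v.2.2 : ℝ)) ^ 2)))) +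
      ∑' m : ℤ, (2 * Real.cos (π * (m : ℝ) / 2) + (-1 : ℝ) ^ m) * Real.exp (-(t * (π ^ 2 * ((m : ℝ)) ^ 2)))) =
    1 / 4 * ((∑' v : ℤ × ℤ × ℤ, Real.exp (-(t * (4 * π ^ 2 * (((v.1 : ℝ)) ^ 2 + ((v.2.1 : ℝ)) ^ 2) + π ^ 2 * ((v.2.2 : ℝ)) ^ 2)))) +
      ((∑' a : ℤ, (-1 : ℝ) ^ a * Real.exp (-(t * (4 * π ^ 2 * ((a : ℝ)) ^ 2)))) +
        (∑' b : ℤ, (-1 : ℝ) ^ b * Real.exp (-(t * (4 * π ^ 2 * ((b : ℝ)) ^ 2)))) +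
          ∑' m : ℤ, (-1 : ℝ) ^ m * Real.exp (-(t * (π ^ 2 * ((m : ℝ)) ^ 2))))) := by
  rw [tetra_twisted_eq_didi_twisted ht]
  ring

end Sums

/-! ### §3 Level by level: equal multiplicities `d_μ` -/

/-- **The twisted weights at the level `μ = m²/4` agree**: Tetra's two axis points `±m/2` weigh `2cos(πm/2) + (−1)^m` each;
Didi's weigh `(−1)^m` each, plus — when `m = 2a` — the four points `(±a,0,0), (0,±a,0)` of weight `(−1)^a`:
`2(2cos(πm/2) + (−1)^m) = 2(−1)^m + [m even]·4(−1)^{m/2}`. With (3.1), `d_μ(Tetra) = d_μ(Didi)` for every `μ` ("a single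
eigenfunction of eigenvalue `4π²n²`" for odd `n = m/2`, "three independent eigenfunctions" for even `n`, on top of the generic
quarter of the torus count). [cite: DoyleRossetti2004, §3; MiatelloRossetti2001, Theorem 3.1] -/
theorem tetra_didi_level_weights_eq (m : ℤ) :
    2 * (2 * Real.cos (π * (m : ℝ) / 2) + (-1 : ℝ) ^ m) =
      2 * (-1 : ℝ) ^ m + (if Even m then 4 * (-1 : ℝ) ^ (m / 2) else 0) := by
  obtain ⟨k, rfl | rfl⟩ := Int.even_or_odd' m
  · rw [if_pos ⟨k, by ring⟩, show (2 * k : ℤ) / 2 = k by omega]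
    have e1 : Real.cos (π * (((2 * k : ℤ)) : ℝ) / 2) = (-1 : ℝ) ^ k := by
      rw [show π * (((2 * k : ℤ)) : ℝ) / 2 = (k : ℝ) * π by push_cast; ring, Real.cos_int_mul_pi]
    rw [e1]
    ring
  · rw [if_neg (Int.not_even_iff_odd.mpr ⟨k, rfl⟩)]
    have e1 : Real.cos (π * (((2 * k + 1 : ℤ)) : ℝ) / 2) = 0 := by
      rw [show π * (((2 * k + 1 : ℤ)) : ℝ) / 2 = (k : ℝ) * π + π / 2 by push_cast; ring, Real.cos_add_pi_div_two,
        Real.sin_int_mul_pi, neg_zero]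
    rw [e1]
    ring

/-- **Doyle–Rossetti's exceptional counts**: at `μ = n²` (`m = 2n`) the total twisted weight is `4(−1)^n + 2`, i.e. `−2` for
odd `n` and `+6` for even `n`; at `μ = (n+½)²` (`m` odd) it is `−2` for both manifolds. [cite: DoyleRossetti2004, §3] -/
theorem tetra_didi_exceptional_weights (n : ℤ) :
    2 * (2 * Real.cos (π * (((2 * n : ℤ)) : ℝ) / 2) + (-1 : ℝ) ^ (2 * n)) = 4 * (-1 : ℝ) ^ n + 2 ∧
      2 * (2 * Real.cos (π * (((2 * n + 1 : ℤ)) : ℝ) / 2) + (-1 : ℝ) ^ (2 * n + 1)) = -2 := by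
  have e1 : Real.cos (π * (((2 * n : ℤ)) : ℝ) / 2) = (-1 : ℝ) ^ n := by
    rw [show π * (((2 * n : ℤ)) : ℝ) / 2 = (n : ℝ) * π by push_cast; ring, Real.cos_int_mul_pi]
  have e2 : Real.cos (π * (((2 * n + 1 : ℤ)) : ℝ) / 2) = 0 := by
    rw [show π * (((2 * n + 1 : ℤ)) : ℝ) / 2 = (n : ℝ) * π + π / 2 by push_cast; ring, Real.cos_add_pi_div_two,
      Real.sin_int_mul_pi, neg_zero]
  have e3 : (-1 : ℝ) ^ (2 * n) = 1 := Even.neg_one_zpow ⟨n, by ring⟩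
  have e4 : (-1 : ℝ) ^ (2 * n + 1) = -1 := by
    rw [zpow_add₀ (by norm_num : (-1 : ℝ) ≠ 0), e3, zpow_one]
    ring
  rw [e1, e2, e3, e4]
  constructor <;> ring

end Literature.Analysis.InnerProduct
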